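import Literature.Computability.AlgebraicComplexity.FormChartDimensionCount
import Literature.Computability.AlgebraicComplexity.StabilizerEigenbasisCharts
import Literature.Computability.AlgebraicComplexity.InvariantMonomialCount
import Literature.Computability.AlgebraicComplexity.Poonen05HypersurfaceLinearAutomorphisms
import Literature.Computability.AlgebraicComplexity.SmoothFormFiniteStabilizerAllFields
import Literature.AlgebraicGeometry.Motives.GeneralNonsingularForms
import Literature.NumberTheory.Automorphic.ProjectiveElimination
import Mathlib.LinearAlgebra.Eigenspace.Semisimple
import HarnessLib

/-!
# Generic forms have a trivial stabilizer: all fields (semisimple part), characteristic `0` (in full)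

Topic `Literature/Computability/AlgebraicComplexity` (cell `val-lit`, row X3-Poonen05). Theorems only —
no definition, no named fact.

Poonen, *Varieties without extra automorphisms III: hypersurfaces*, FFA 11 (2005), Thm. 3 (p0002:L19):
"Suppose that `n ≥ 1`, `d ≥ 3`, and `(n, d) ≠ (1, 3)`. Then `U_{n,d}` is nonempty. In other words, the
generic hypersurface `X` of degree `d` in `ℙ^{n+1}` has `Lin X = {1}`" (Matsumura–Monsky 1964 for
`n ≥ 2`; Chang / Katz–Sarnak for plane curves). The tree's named fact `poonen2005_thm_3`
(`Poonen05HypersurfaceLinearAutomorphisms.lean`) quantifies over EVERY algebraically closed field `K`;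
its `K = ℂ` instance is `poonen2005_thm_3_complex` (`GenericTrivialStabilizerProofs.lean`, val-lit-x3 g3,
whose only `ℂ`-specific inputs were the generic FINITENESS of the stabilizer, taken from the Lie-algebra
criterion over `ℂ`, and generic smoothness with the Fermat witness). This file removes the `ℂ`:

* § 1 `isZariskiGeneric_isNonsingularForm_of_isAlgClosed` — **almost all forms of degree `D ≥ 1` in
  `n + 2` variables are nonsingular, over every algebraically closed field of ANY characteristic** (the
  first clause of Thm. 3 in full generality): elimination theory on `K`-points (tree
  `isClosed_setOf_exists_common_zero`, Springer 6.1.3) applied to the generic form AND its partials,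
  with the witness `Σ xᵢ^D` when `D ≠ 0` in `K` and the chain form `x₀^D + Σ xᵢ x_{i+1}^{D-1}` when
  `D = 0` in `K` (tree `isNonsingularForm_sum_X_pow` / `isNonsingularForm_chainForm`, Hartshorne I 5.5).
* § 2 `exists_eigenChart_of_mul_eq_mul_diagonal` — the eigen-chart of `StabilizerEigenbasisCharts` for a
  stabilizer element GIVEN a diagonalisation `γ P = P diag(c)` (any field; x3 g3's
  `exists_eigenChart_of_pow_eq_one` minus its first line).
* § 3 `isZariskiGeneric_forall_mem_linStabilizer_diagonalizable` — **over ANY field, for `D ≥ 3`,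
  `m ≥ 3`, `(D,m) ≠ (3,3)`, almost all forms of degree `D` in `m` variables have NO non-scalar
  DIAGONALISABLE stabilizer element** (every `γ ∈ stab(f)` with `γ P = P diag(c)`, `P` invertible, is
  `ζ · 1`, `ζ^D = 1`): the Matsumura–Monsky count `#S_c + #{(i,j) : cᵢ ≠ cⱼ} < N` (tree
  `card_invariant_add_card_cross_lt`, val-lit-p4 g5) and the chart criterion
  (`isZariskiGeneric_not_mem_chartImage`). This is the semisimple half of Thm. 3 in every characteristic.
* § 4 `exists_mul_eq_mul_diagonal_of_isSemisimple` / `…_of_pow_eq_one_of_natCast_ne_zero` — over an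
  algebraically closed field a semisimple matrix, in particular one with `A^N = 1`, `N ≠ 0` in `K`, is
  diagonalisable (Mathlib `Module.End.IsSemisimple.iSup_eigenspace_eq_top`; the tree's
  `LinearSubstitution.exists_mul_eq_mul_diagonal_of_pow_eq_one` is the `[CharZero K]` case), hence
  `isZariskiGeneric_forall_mem_linStabilizer_pow_eq_one`: **over every algebraically closed field, almost
  all forms have no non-scalar stabilizer element of order invertible in `K`** (order prime to `p`).
* § 5 `isZariskiGeneric_finite_linStabilizer_of_natCast_ne_zero` (generic finiteness over every
  algebraically closed `K` with `D ≠ 0` in `K`, from § 1 and t14's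
  `finite_linStabilizer_of_isNonsingularForm_of_natCast_ne_zero`),
  **`isZariskiGeneric_hasTrivialStabilizer_of_charZero`** (almost all forms of degree `D ≥ 3` in `m ≥ 3`
  variables, `(D,m) ≠ (3,3)`, have `stab = μ_D · 1`, over EVERY algebraically closed field of
  characteristic `0`), the characteristic-`p ∤ D` form `isZariskiGeneric_forall_mem_linStabilizer_of_natCast_ne_zero`
  (finite stabilizer all of whose elements of order prime to `p` are scalar), and
  **`poonen2005_thm_3_of_charZero`** — the body of the fact `poonen2005_thm_3` VERBATIM plus the single
  hypothesis `[CharZero K]` (sibling of `SmoothFormFiniteStabilizerAllFields.poonen2005_thm_2_of_charZero`).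

Typed vs printed / what stays open. The fact `poonen2005_thm_3` itself (every algebraically closed
field, ANY characteristic) is NOT discharged and stays OPEN BY NAME. After this file its residue in
characteristic `p > 0` is exactly the UNIPOTENT part: by Jordan–Chevalley (Mathlib
`Module.End.exists_isNilpotent_isSemisimple`) a stabilizer element factors `γ = γ_s γ_u`; § 3 kills a
non-scalar `γ_s` in every characteristic, and what remains is "almost all forms admit no stabilizer
element `u ≠ 1` with `(u - 1)^p = 0`" — Matsumura–Monsky's count over the unipotent classes of
order `p` (fixed-point dimensions of `ℤ/p` on `Sym^D K^m`, Jordan type by Jordan type), not in the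
tree. In characteristic `p ∤ D` the finiteness of § 5 reduces the residue to the same statement
(`γ^{N'}` is unipotent for the `p'`-part `N'` of the order). Honest framing: classical
(Matsumura–Monsky 1964); re-proved by counting; typed ≠ endorsed; nothing here bears on VP versus VNP,
which is NOT proved.

## References

* B. Poonen, *Varieties without extra automorphisms III: hypersurfaces*, Finite Fields Appl. 11
  (2005) 230–268, Thm. 3 (p0002:L19, held text `paper:doi-10-1016-j-ffa-2004-12-001`). [Poonen2005]
* H. Matsumura, P. Monsky, *On the automorphisms of hypersurfaces*, J. Math. Kyoto Univ. 3 (1963/64)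
  347–361 (Poonen's [MM]; not held, acq-11400). [MatsumuraMonsky1963]
* P. Bürgisser, C. Ikenmeyer, *Fundamental invariants of orbit closures*, J. Algebra 477 (2017), §2.1
  ("almost all `w ∈ Sym^D ℂ^m` have a trivial stabilizer"). [BurgisserIkenmeyer2017]
* T. A. Springer, *Linear Algebraic Groups*, 2nd ed., 6.1.3 (elimination). [SpringerLAG1998]
* R. Hartshorne, *Algebraic Geometry*, I Ex. 5.5, 5.8. [Hartshorne1977]

## Tree

`IsZariskiGeneric`, `HasTrivialStabilizer`, `formCoeff`, `DegIdx`, `degMonomials`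
(`BI17FundamentalInvariantForms`, `OrbitCoordinateRing`); `chartImage`, `linSubst_mem_chartImage`,
`isZariskiGeneric_not_mem_chartImage`, `IsZariskiGeneric.forall_fintype` (`FormChartDimensionCount`);
`invMonomials`, `blkOf`, `chartVars`, `chartMatrix`, `card_chartVars`, `exists_pivot_decomposition`
(`StabilizerEigenbasisCharts`); `card_invariant_add_card_cross_lt` (`InvariantMonomialCount`);
`HasTrivialLinAut`, `hasTrivialLinAut_iff_hasTrivialStabilizer`, `ne_zero_of_isNonsingularForm`,
`pow_eq_one_of_smul_one_mem_linStabilizer`, `poonen2005_thm_3` (`Poonen05HypersurfaceLinearAutomorphisms`);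
`finite_linStabilizer_of_isNonsingularForm_of_natCast_ne_zero` (`SmoothFormFiniteStabilizerAllFields`);
`isClosed_setOf_exists_common_zero`, `specialize`, `isClosed_iff_exists_setOf_eval`
(`NumberTheory/Automorphic`); `IsNonsingularForm`, `IsNonsingularForm.exists_eval_pderiv_ne_zero`,
`isNonsingularForm_of_forall_exists_eval_pderiv_ne_zero`, `isNonsingularForm_sum_X_pow`, `chainForm`,
`isHomogeneous_chainForm`, `isNonsingularForm_chainForm` (`AlgebraicGeometry/Motives`).

## Provenance

Cell `val-lit`, seat `val-lit-x3` generation 8 (cross-ladder literature seat; row X3 residue).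
-/

noncomputable section

open MvPolynomial Matrix

namespace Literature.Computability.AlgebraicComplexity

open _root_.Literature.AlgebraicGeometry.Motives.SmoothHypersurface

/-! ### § 0 Field-general bookkeeping for `IsZariskiGeneric` -/

section Bookkeeping

variable {σ K : Type*} [Fintype σ] [DecidableEq σ] [Field K] {D : ℕ}

/-- Two Zariski-generic properties hold simultaneously for almost all forms (product of the test
polynomials; field-general copy of the tree's `IsZariskiGeneric.and`, which is typed over `ℂ`).
[cite: BurgisserIkenmeyer2017, §2.1 ("almost all")] -/
theorem IsZariskiGeneric.and' {P Q : MvPolynomial σ K → Prop} (hP : IsZariskiGeneric D P)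
    (hQ : IsZariskiGeneric D Q) : IsZariskiGeneric D fun f => P f ∧ Q f := by
  obtain ⟨F, hF0, hF⟩ := hP
  obtain ⟨G, hG0, hG⟩ := hQ
  refine ⟨F * G, mul_ne_zero hF0 hG0, fun f hf hFG => ?_⟩
  rw [map_mul] at hFG
  exact ⟨hF f hf (left_ne_zero_of_mul hFG), hG f hf (right_ne_zero_of_mul hFG)⟩

/-- A Zariski-generic property implies any weaker property generically (field-general copy of the
tree's `IsZariskiGeneric.mono`, typed over `ℂ`). [cite: BurgisserIkenmeyer2017, §2.1 ("almost all")] -/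
theorem IsZariskiGeneric.mono' {P Q : MvPolynomial σ K → Prop} (hP : IsZariskiGeneric D P)
    (hPQ : ∀ f : MvPolynomial σ K, f.IsHomogeneous D → P f → Q f) : IsZariskiGeneric D Q := by
  obtain ⟨F, hF0, hF⟩ := hP
  exact ⟨F, hF0, fun f hf hFf => hPQ f hf (hF f hf hFf)⟩

/-- A property true of all forms is Zariski-generic (test polynomial `1`). [folklore] -/
private theorem isZariskiGeneric_of_forall' {P : MvPolynomial σ K → Prop} (h : ∀ f, P f) :
    IsZariskiGeneric D P :=
  ⟨1, one_ne_zero, fun f _ _ => h f⟩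

/-- Generic forms are nonzero, over any field (test polynomial: the coordinate of `x_{i₀}^D`;
field-general copy of the tree's `isZariskiGeneric_ne_zero`). [folklore] -/
private theorem isZariskiGeneric_ne_zero' [Nonempty σ] (D : ℕ) :
    IsZariskiGeneric D fun f : MvPolynomial σ K => f ≠ 0 := by
  obtain ⟨i₀⟩ := ‹Nonempty σ›
  have hd : Finsupp.single i₀ D ∈ degMonomials σ D := by
    rw [mem_degMonomials_iff, Finsupp.degree_single]
  refine ⟨X ⟨_, hd⟩, X_ne_zero _, fun f _ hF => ?_⟩
  rintro rfl
  rw [aeval_X, formCoeff_apply, coeff_zero] at hF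
  exact hF rfl

end Bookkeeping

/-! ### § 1 Almost all forms are nonsingular — every algebraically closed field, any characteristic -/

section Nonsingular

variable {K : Type*} [Field K] [IsAlgClosed K] {n D : ℕ}

/-- A nonsingular form of degree `D ≥ 1` in `n + 2` variables exists over every field: the Fermat form
`Σ xᵢ^D` if `D ≠ 0` in `K`, the chain form `x₀^D + Σ xᵢ x_{i+1}^{D-1}` if `D = 0` in `K` (then `D ≥ 2`).
[cite: Hartshorne1977, I Ex. 5.5] -/
theorem exists_isHomogeneous_isNonsingularForm (K : Type*) [Field K] (n : ℕ) {D : ℕ} (hD : 0 < D) :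
    ∃ F₀ : MvPolynomial (Fin (n + 2)) K, F₀.IsHomogeneous D ∧ IsNonsingularForm K F₀ := by
  by_cases hDK : (D : K) = 0
  · have h2 : 2 ≤ D := by
      rcases Nat.lt_or_ge D 2 with h | h
      · exfalso
        interval_cases D
        exact one_ne_zero (by rwa [Nat.cast_one] at hDK)
      · exact h
    exact ⟨chainForm K n D, isHomogeneous_chainForm K n D hD,
      isNonsingularForm_chainForm (k := K) (n := n) (d := D) hDK h2⟩
  · exact ⟨∑ i : Fin (n + 2), X i ^ D,
      IsHomogeneous.sum _ _ _ fun i _ => isHomogeneous_X_pow i D,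
      isNonsingularForm_sum_X_pow hDK⟩

open Literature.NumberTheory.Automorphic in
/-- **Almost every form has non-vanishing gradient at each of its non-zero zeros** (`D ≥ 1`,
`n + 2 ≥ 2` variables, every algebraically closed field, ANY characteristic): there is a non-zero
polynomial `Φ` in the coefficients of `Sym^D K^{n+2}` such that every form `F` of degree `D` with
`Φ(F) ≠ 0` satisfies `∀ z ≠ 0, F(z) = 0 → ∃ j, (∂_j F)(z) ≠ 0`. Elimination theory (Springer 6.1.3,
tree `isClosed_setOf_exists_common_zero`) applied to the generic form TOGETHER WITH its partials (in
characteristic `p ∣ D` the partials alone may have a common zero off the hypersurface), witness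
`exists_isHomogeneous_isNonsingularForm`. The `K = ℂ` case is the tree's
`isZariskiGeneric_forall_exists_eval_pderiv_ne_zero` (val-lit-p4 g5), whose proof this follows.
[cite: Poonen2005, Thm. 3 (first clause)] -/
theorem isZariskiGeneric_forall_exists_eval_pderiv_ne_zero_of_isAlgClosed (hD : 0 < D) :
    IsZariskiGeneric D fun F : MvPolynomial (Fin (n + 2)) K =>
      ∀ z : Fin (n + 2) → K, z ≠ 0 → eval z F = 0 → ∃ j, eval z (pderiv j F) ≠ 0 := by
  classical
  -- the generic form of degree `D` over the coefficient ring `K[Sym^D K^{n+2}]`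
  set G : MvPolynomial (Fin (n + 2)) (MvPolynomial (DegIdx (Fin (n + 2)) D) K) :=
    ∑ d : DegIdx (Fin (n + 2)) D, C (X d) * monomial d.1 1 with hG
  have hGhom : G.IsHomogeneous D :=
    IsHomogeneous.sum _ _ _ fun d _ =>
      (isHomogeneous_monomial (1 : MvPolynomial (DegIdx (Fin (n + 2)) D) K)
        (mem_degMonomials_iff.mp d.2)).C_mul _
  -- its specialisation at the coefficient vector of a form `F` of degree `D` is `F`
  have hspec : ∀ F : MvPolynomial (Fin (n + 2)) K, F.IsHomogeneous D →
      specialize (formCoeff D F) G = F := by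
    intro F hF
    rw [specialize, hG, map_sum]
    conv_rhs => rw [← sum_coeff_smul_monomial_eq hF]
    refine Finset.sum_congr rfl fun d _ => ?_
    rw [map_mul, map_C, eval_X, map_monomial, map_one, formCoeff_apply, smul_eq_C_mul]
  -- the family `(G, ∂₀ G, …, ∂_{n+1} G)`, homogeneous of degrees `(D, D - 1, …, D - 1)`
  set f : Fin (n + 3) → MvPolynomial (Fin (n + 2)) (MvPolynomial (DegIdx (Fin (n + 2)) D) K) :=
    Fin.cons G fun j => pderiv j G with hf
  have hf0 : f 0 = G := by rw [hf]; exact Fin.cons_zero _ _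
  have hfs : ∀ j : Fin (n + 2), f j.succ = pderiv j G := fun j => by rw [hf]; exact Fin.cons_succ _ _ j
  have hfhom : ∀ j, (f j).IsHomogeneous ((Fin.cons D fun _ : Fin (n + 2) => D - 1 : Fin (n + 3) → ℕ) j) := by
    intro j
    refine Fin.cases ?_ (fun i => ?_) j
    · rw [hf0, Fin.cons_zero]; exact hGhom
    · rw [hfs, Fin.cons_succ]; exact hGhom.pderiv
  have hfspec0 : ∀ F : MvPolynomial (Fin (n + 2)) K, F.IsHomogeneous D →
      specialize (formCoeff D F) (f 0) = F := fun F hF => by rw [hf0, hspec F hF]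
  have hfspecs : ∀ F : MvPolynomial (Fin (n + 2)) K, F.IsHomogeneous D → ∀ j : Fin (n + 2),
      specialize (formCoeff D F) (f j.succ) = pderiv j F := by
    intro F hF j
    rw [hfs, specialize, ← pderiv_map, ← specialize, hspec F hF]
  -- membership in the bad set ↔ a singular point of the hypersurface
  have hbad : ∀ F : MvPolynomial (Fin (n + 2)) K, F.IsHomogeneous D →
      (formCoeff D F ∈ {y : DegIdx (Fin (n + 2)) D → K |
        ∃ x : Fin (n + 2) → K, x ≠ 0 ∧ ∀ j, eval x (specialize y (f j)) = 0} ↔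
      ∃ z : Fin (n + 2) → K, z ≠ 0 ∧ eval z F = 0 ∧ ∀ j, eval z (pderiv j F) = 0) := by
    intro F hF
    simp only [Set.mem_setOf_eq]
    constructor
    · rintro ⟨z, hz, hall⟩
      refine ⟨z, hz, ?_, fun j => ?_⟩
      · have h := hall 0
        rwa [hfspec0 F hF] at h
      · have h := hall j.succ
        rwa [hfspecs F hF] at h
    · rintro ⟨z, hz, hFz, hgrad⟩
      refine ⟨z, hz, fun j => Fin.cases ?_ (fun i => ?_) j⟩
      · rw [hfspec0 F hF]; exact hFz
      · rw [hfspecs F hF]; exact hgrad i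
  -- the singular forms are a Zariski-closed set of coefficient vectors …
  have hS := isClosed_setOf_exists_common_zero f hfhom
  obtain ⟨T, hT⟩ := isClosed_iff_exists_setOf_eval.mp hS
  -- … missing a nonsingular witness
  obtain ⟨F₀, hF₀hom, hF₀ns⟩ := exists_isHomogeneous_isNonsingularForm K n hD
  have hy₀ : formCoeff D F₀ ∉ {y : DegIdx (Fin (n + 2)) D → K |
      ∃ x : Fin (n + 2) → K, x ≠ 0 ∧ ∀ j, eval x (specialize y (f j)) = 0} := by
    intro h
    obtain ⟨z, hz, hz0, hgrad⟩ := (hbad F₀ hF₀hom).mp h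
    obtain ⟨j, hj⟩ := hF₀ns.exists_eval_pderiv_ne_zero hz hz0
    exact hj (hgrad j)
  rw [hT] at hy₀
  simp only [Set.mem_setOf_eq, not_forall] at hy₀
  obtain ⟨Φ, hΦT, hΦ0⟩ := hy₀
  refine ⟨Φ, fun h => hΦ0 (by rw [h, map_zero]), fun F hF hΦF z hz hFz => ?_⟩
  -- off `Φ = 0` the gradient does not vanish at a non-zero zero
  by_contra hgrad
  push Not at hgrad
  have hmem : formCoeff D F ∈ {y : DegIdx (Fin (n + 2)) D → K |
      ∃ x : Fin (n + 2) → K, x ≠ 0 ∧ ∀ j, eval x (specialize y (f j)) = 0} :=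
    (hbad F hF).mpr ⟨z, hz, hFz, hgrad⟩
  rw [hT] at hmem
  have hval : eval (formCoeff D F) Φ = 0 := hmem Φ hΦT
  exact hΦF (by rw [← hval]; rfl)

/-- **Almost all forms of degree `D ≥ 1` in `n + 2 ≥ 2` variables are nonsingular, over every
algebraically closed field of any characteristic** (`IsNonsingularForm K`, Hartshorne I Ex. 5.8): the
first clause of Poonen 2005 Thm. 3 ("for generic `F`, `X = {F = 0}` is smooth") as a
Bürgisser–Ikenmeyer `IsZariskiGeneric` statement, now without the restriction `K = ℂ` of the tree's
`isZariskiGeneric_isNonsingularForm`. [cite: Poonen2005, Thm. 3 (first clause)] -/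
theorem isZariskiGeneric_isNonsingularForm_of_isAlgClosed (hD : 0 < D) :
    IsZariskiGeneric D (IsNonsingularForm K : MvPolynomial (Fin (n + 2)) K → Prop) :=
  (isZariskiGeneric_forall_exists_eval_pderiv_ne_zero_of_isAlgClosed hD).mono' fun _ _ h =>
    isNonsingularForm_of_forall_exists_eval_pderiv_ne_zero h

end Nonsingular

/-! ### § 2 The eigen-chart of a diagonalisable stabilizer element (any field) -/

section EigenChart

variable {m : ℕ} {K : Type*} [Field K]

/-- **Eigenbasis chart, any field.** Let `γ` be an invertible linear substitution stabilising a form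
`w` of degree `D`, DIAGONALISABLE over `K`: `γ P = P diag(c)` with `P` invertible. Then all `cᵢ ≠ 0`;
`γ` is the scalar `c_{i₀} · 1` when all eigenvalues coincide; and in any case `w = g · v` where `v` is
a form of degree `D` supported on the `diag(c)`-invariant monomials `invMonomials D c` and `g` is a
specialisation of the pivot chart matrix `chartMatrix K (blkOf c) ρ` for some choice of pivot rows
`ρ` injective on the eigenvalue blocks (the tree's `exists_eigenChart_of_pow_eq_one` with the
diagonalisation as a hypothesis instead of "finite order over an algebraically closed field of
characteristic `0`"). [cite: BurgisserIkenmeyer2017, §2.1 ("almost all w ∈ Sym^D ℂ^m have a trivial stabilizer")] -/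
theorem exists_eigenChart_of_mul_eq_mul_diagonal {D : ℕ} {w : MvPolynomial (Fin m) K}
    (hw : w.IsHomogeneous D) {γ P : Matrix (Fin m) (Fin m) K} {c : Fin m → K}
    (hγ : IsUnit γ.det) (hP : IsUnit P.det) (hPc : γ * P = P * diagonal c)
    (hstab : linSubst (Fin m) K γ w = w) :
    (∀ i, c i ≠ 0) ∧ (∀ i₀, (∀ i, c i = c i₀) → γ = c i₀ • (1 : Matrix _ _ K)) ∧
      ∃ ρ : Fin m → Fin m, (∀ j j', blkOf c j = blkOf c j' → ρ j = ρ j' → j = j') ∧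
        ∃ (p : chartVars (blkOf c) ρ → K) (v : MvPolynomial (Fin m) K),
          v.IsHomogeneous D ∧ v.support ⊆ invMonomials D c ∧
          w = linSubst (Fin m) K ((chartMatrix K (blkOf c) ρ).map (MvPolynomial.eval p)) v := by
  classical
  -- the eigenvalues are nonzero: `det γ = ∏ c_i`
  have hprod : ∏ i, c i = γ.det := by
    have h := congrArg Matrix.det hPc
    rw [det_mul, det_mul, det_diagonal, mul_comm] at h
    exact (mul_left_cancel₀ hP.ne_zero h).symm
  have hc0 : ∀ i, c i ≠ 0 := fun i hi =>
    hγ.ne_zero (by rw [← hprod]; exact Finset.prod_eq_zero (Finset.mem_univ i) hi)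
  have hPP : P * P⁻¹ = 1 := Matrix.mul_nonsing_inv P hP
  have hP'P : P⁻¹ * P = 1 := Matrix.nonsing_inv_mul P hP
  refine ⟨hc0, ?_, ?_⟩
  · -- scalar case
    intro i₀ hci
    have hdiag : diagonal c = c i₀ • (1 : Matrix (Fin m) (Fin m) K) := by
      ext i j
      rw [diagonal_apply, Matrix.smul_apply, Matrix.one_apply, smul_eq_mul, mul_ite, mul_one, mul_zero]
      split_ifs with h
      · subst h; exact hci i
      · rfl
    calc γ = γ * P * P⁻¹ := by rw [Matrix.mul_assoc, hPP, Matrix.mul_one]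
      _ = P * (c i₀ • (1 : Matrix (Fin m) (Fin m) K)) * P⁻¹ := by rw [hPc, hdiag]
      _ = c i₀ • (1 : Matrix (Fin m) (Fin m) K) := by
        rw [Matrix.mul_smul, Matrix.mul_one, Matrix.smul_mul, hPP]
  · -- the chart: `v₀ = P⁻¹ · w` is `diag(c)`-invariant and `w = P · v₀`
    set v₀ := linSubst (Fin m) K P⁻¹ w with hv₀
    have hv₀hom : v₀.IsHomogeneous D := linSubst_isHomogeneous _ hw
    have hconj : P⁻¹ * γ * P = diagonal c := by
      rw [Matrix.mul_assoc, hPc, ← Matrix.mul_assoc, hP'P, Matrix.one_mul]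
    have hv₀inv : linSubst (Fin m) K (diagonal c) v₀ = v₀ := by
      rw [hv₀, ← hconj, linSubst_mul, linSubst_mul, AlgHom.comp_apply, AlgHom.comp_apply,
        ← AlgHom.comp_apply (linSubst (Fin m) K P), ← linSubst_mul, hPP, linSubst_one,
        AlgHom.id_apply, hstab]
    have hwv₀ : w = linSubst (Fin m) K P v₀ := by
      rw [hv₀, ← AlgHom.comp_apply, ← linSubst_mul, hPP, linSubst_one, AlgHom.id_apply]
    -- pivot decomposition `P = g · l` for the eigenvalue blocks
    obtain ⟨ρ, hρ, l, g, hl0, -, hg, hPgl⟩ := exists_pivot_decomposition (blkOf c) P hP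
    have hlc : l * diagonal c = diagonal c * l :=
      mul_diagonal_eq_diagonal_mul_of_apply_eq_zero fun i j hij =>
        hl0 i j (mt (blkOf_eq_blkOf_iff c i j).mp hij)
    refine ⟨ρ, hρ, fun q => g q.1.1 q.1.2, linSubst (Fin m) K l v₀,
      linSubst_isHomogeneous _ hv₀hom,
      support_subset_invMonomials (linSubst_isHomogeneous _ hv₀hom)
        (linSubst_diagonal_linSubst_eq hlc hv₀inv), ?_⟩
    rw [chartMatrix_map_eval hρ hg, ← AlgHom.comp_apply, ← linSubst_mul, ← hPgl]
    exact hwv₀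

end EigenChart

/-! ### § 3 Almost all forms have no non-scalar diagonalisable stabilizer element (any field) -/

section Diagonalizable

variable {m D : ℕ} {K : Type*} [Field K]

/-- **Matsumura–Monsky's count, semisimple part, over ANY field**: for `D ≥ 3`, `m ≥ 3`,
`(D,m) ≠ (3,3)`, almost all forms `f` of degree `D` in `m` variables have the property that every
DIAGONALISABLE stabilizer element (`γ ∈ stab(f)`, `γ P = P diag(c)` with `P` invertible over `K`) is a
scalar `ζ · 1` with `ζ^D = 1`. Proof = x3 g3's over `ℂ` with the diagonalisation as data: a
non-scalar `γ` puts `f` in an eigen-chart with `#{(i,j) : cᵢ ≠ cⱼ} + #S_c < N` parameters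
(`card_invariant_add_card_cross_lt`), which almost all forms avoid (`isZariskiGeneric_not_mem_chartImage`).
[cite: BurgisserIkenmeyer2017, §2.1 ("almost all w ∈ Sym^D ℂ^m have a trivial stabilizer")] -/
theorem isZariskiGeneric_forall_mem_linStabilizer_diagonalizable (hD : 3 ≤ D) (hm : 3 ≤ m)
    (h33 : D = 3 → 4 ≤ m) :
    IsZariskiGeneric D fun f : MvPolynomial (Fin m) K =>
      ∀ γ ∈ linStabilizer f, ∀ (P : Matrix (Fin m) (Fin m) K) (c : Fin m → K), IsUnit P.det →
        (γ : Matrix (Fin m) (Fin m) K) * P = P * diagonal c →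
        ∃ ζ : K, ζ ^ D = 1 ∧ (γ : Matrix (Fin m) (Fin m) K) = ζ • (1 : Matrix (Fin m) (Fin m) K) := by
  classical
  haveI : Nonempty (Fin m) := ⟨⟨0, by omega⟩⟩
  -- generic non-vanishing
  obtain ⟨F₀, hF₀0, hF₀⟩ := isZariskiGeneric_ne_zero' (σ := Fin m) (K := K) D
  -- generic avoidance of every small eigen-chart
  -- charts are indexed by (block labels, pivot rows, support ⊆ degree-`D` monomials)
  have hchart : ∀ a : (Fin m → Fin m) × (Fin m → Fin m) × ↥((degMonomials (Fin m) D).powerset),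
      IsZariskiGeneric D fun f : MvPolynomial (Fin m) K =>
      Fintype.card (chartVars a.1 a.2.1) + a.2.2.1.card < (degMonomials (Fin m) D).card →
        f ∉ chartImage (chartMatrix K a.1 a.2.1) a.2.2.1 := by
    intro a
    by_cases hlt : Fintype.card (chartVars a.1 a.2.1) + a.2.2.1.card < (degMonomials (Fin m) D).card
    · obtain ⟨F, hF0, hF⟩ := isZariskiGeneric_not_mem_chartImage D (chartMatrix K a.1 a.2.1)
        a.2.2.1 hlt
      exact ⟨F, hF0, fun f hf hFf _ => hF f hf hFf⟩
    · exact isZariskiGeneric_of_forall' fun f h => absurd h hlt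
  obtain ⟨F₂, hF₂0, hF₂⟩ := IsZariskiGeneric.forall_fintype hchart
  refine ⟨F₀ * F₂, mul_ne_zero hF₀0 hF₂0, fun f hf hFf => ?_⟩
  rw [map_mul] at hFf
  have hf0 : f ≠ 0 := hF₀ f hf (left_ne_zero_of_mul hFf)
  have havoid := hF₂ f hf (right_ne_zero_of_mul hFf)
  intro γ hγ P c hP hPc
  have hstab : linSubst (Fin m) K (γ : Matrix (Fin m) (Fin m) K) f = f := by
    rw [← linSubstRep_apply]; exact mem_linStabilizer.mp hγ
  have hγdet : IsUnit (γ : Matrix (Fin m) (Fin m) K).det :=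
    (Matrix.GeneralLinearGroup.det_ne_zero γ).isUnit
  obtain ⟨hc0, hscalar, ρ, hρ, p, v, hvhom, hvsupp, hfv⟩ :=
    exists_eigenChart_of_mul_eq_mul_diagonal hf hγdet hP hPc hstab
  by_cases hconst : ∃ i j, c i ≠ c j
  · -- non-scalar: the form lies in a small chart, contradiction
    exfalso
    have hS : invMonomials D c ⊆ degMonomials (Fin m) D := invMonomials_subset D c
    have hlt : Fintype.card (chartVars (blkOf c) ρ) + (invMonomials D c).card <
        (degMonomials (Fin m) D).card := by
      rw [card_chartVars hρ]
      have hfilt : (Finset.univ.filter fun q : Fin m × Fin m => blkOf c q.1 ≠ blkOf c q.2) =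
          Finset.univ.filter fun q : Fin m × Fin m => c q.1 ≠ c q.2 :=
        Finset.filter_congr fun q _ => not_congr (blkOf_eq_blkOf_iff c q.1 q.2)
      rw [hfilt, add_comm]
      have h := card_invariant_add_card_cross_lt c hc0 hD hm h33 hconst
      convert h using 2
      congr 1
    exact havoid ⟨blkOf c, ρ, ⟨invMonomials D c, Finset.mem_powerset.mpr hS⟩⟩ hlt
      (hfv ▸ linSubst_mem_chartImage _ p hvsupp)
  · -- scalar: `γ = ζ · 1` with `ζ^D = 1`
    have hall : ∀ i j, c i = c j := fun i j => by
      by_contra h; exact hconst ⟨i, j, h⟩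
    have i₀ : Fin m := ⟨0, by omega⟩
    have hγeq : ((γ : GL (Fin m) K) : Matrix (Fin m) (Fin m) K) = c i₀ • (1 : Matrix _ _ K) :=
      hscalar i₀ fun i => hall i i₀
    exact ⟨c i₀, pow_eq_one_of_smul_one_mem_linStabilizer hf hf0 hγ hγeq, hγeq⟩

end Diagonalizable

/-! ### § 4 Diagonalisation of semisimple matrices over an algebraically closed field -/

section Semisimple

variable {ι K : Type*} [Fintype ι] [DecidableEq ι] [Field K] [IsAlgClosed K]

/-- **A semisimple matrix over an algebraically closed field is diagonalisable**: if the endomorphism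
`x ↦ A x` of `K^ι` is semisimple, there are an invertible `P` and `c` with `A P = P diag(c)` (its
eigenspaces span, Mathlib `Module.End.IsSemisimple.iSup_eigenspace_eq_top`; take `P` = an eigenbasis).
The tree's `LinearSubstitution.exists_mul_eq_mul_diagonal_of_pow_eq_one` is the finite-order,
characteristic-`0` instance; same construction. [cite: Humphreys1990, § 3.8 ("acts via a diagonal matrix relative to a suitable basis")] -/
theorem exists_mul_eq_mul_diagonal_of_isSemisimple {A : Matrix ι ι K}
    (hss : Module.End.IsSemisimple (Matrix.toLinAlgEquiv' A)) :
    ∃ (P : Matrix ι ι K) (c : ι → K), IsUnit P.det ∧ A * P = P * diagonal c := by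
  classical
  -- eigenspace decomposition and an eigenbasis
  have hint : DirectSum.IsInternal fun μ : K => Module.End.eigenspace (Matrix.toLinAlgEquiv' A) μ :=
    DirectSum.isInternal_submodule_of_iSupIndep_of_iSup_eq_top
      (Module.End.eigenspaces_iSupIndep _) hss.iSup_eigenspace_eq_top
  let b₀ := hint.collectedBasis fun μ => Module.finBasis K (Module.End.eigenspace (Matrix.toLinAlgEquiv' A) μ)
  haveI : Finite ((μ : K) × Fin (Module.finrank K (Module.End.eigenspace (Matrix.toLinAlgEquiv' A) μ))) :=
    Module.Finite.finite_basis b₀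
  let e : ((μ : K) × Fin (Module.finrank K (Module.End.eigenspace (Matrix.toLinAlgEquiv' A) μ))) ≃ ι :=
    b₀.indexEquiv (Pi.basisFun K ι)
  let b : Module.Basis ι K (ι → K) := b₀.reindex e
  have hb : ∀ i, A.mulVec (b i) = (e.symm i).1 • b i := by
    intro i
    have hmem : b₀ (e.symm i) ∈ Module.End.eigenspace (Matrix.toLinAlgEquiv' A) (e.symm i).1 :=
      hint.collectedBasis_mem _ _
    rw [Module.End.mem_eigenspace_iff, Matrix.toLinAlgEquiv'_apply] at hmem
    simpa only [b, Module.Basis.reindex_apply] using hmem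
  -- the matrix `P` of the eigenbasis
  refine ⟨Matrix.of fun k i => b i k, fun i => (e.symm i).1, ?_, ?_⟩
  · -- `P = (basisFun).toMatrix b` is invertible
    have e1 : (Matrix.of fun k i => b i k) = (Pi.basisFun K ι).toMatrix b := by
      ext k i
      rw [Matrix.of_apply, Module.Basis.toMatrix_apply, Pi.basisFun_repr]
    rw [e1]
    exact Matrix.isUnit_det_of_right_inverse ((Pi.basisFun K ι).toMatrix_mul_toMatrix_flip b)
  · ext k i
    have h := congrFun (hb i) k
    rw [Pi.smul_apply, smul_eq_mul] at h
    rw [Matrix.mul_diagonal, Matrix.mul_apply, Matrix.of_apply]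
    simp only [Matrix.of_apply]
    rw [mul_comm (b i k), ← h, Matrix.mulVec, dotProduct]

/-- **A matrix of finite order invertible in `K` is diagonalisable** over an algebraically closed
field: `A^N = 1` with `N ≠ 0` in `K` (i.e. the characteristic does not divide `N`) gives `P`
invertible and `c` with `A P = P diag(c)` (the minimal polynomial divides the separable `X^N - 1`).
The `[CharZero K]` case is the tree's `LinearSubstitution.exists_mul_eq_mul_diagonal_of_pow_eq_one`.
[cite: Humphreys1990, § 3.8 ("As an element of finite order in GL(V), each w acts via a diagonal matrix")] -/
theorem exists_mul_eq_mul_diagonal_of_pow_eq_one_of_natCast_ne_zero {A : Matrix ι ι K} {N : ℕ}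
    (hNK : (N : K) ≠ 0) (hA : A ^ N = 1) :
    ∃ (P : Matrix ι ι K) (c : ι → K), IsUnit P.det ∧ A * P = P * diagonal c := by
  have hfm : Polynomial.aeval (Matrix.toLinAlgEquiv' A) (Polynomial.X ^ N - Polynomial.C (1 : K)) = 0 := by
    rw [Polynomial.aeval_algEquiv, AlgHom.comp_apply, map_sub, map_pow, Polynomial.aeval_X,
      Polynomial.aeval_C, map_one, hA, sub_self, map_zero]
  have hsep : Squarefree (Polynomial.X ^ N - Polynomial.C (1 : K)) :=
    (Polynomial.separable_X_pow_sub_C 1 hNK one_ne_zero).squarefree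
  exact exists_mul_eq_mul_diagonal_of_isSemisimple
    (Module.End.isSemisimple_of_squarefree_aeval_eq_zero hsep hfm)

end Semisimple

/-! ### § 5 Consequences over algebraically closed fields -/

section AlgClosed

variable {m n D : ℕ} {K : Type*} [Field K] [IsAlgClosed K]

/-- **Over every algebraically closed field (any characteristic), almost all forms of degree `D ≥ 3`
in `m ≥ 3` variables, `(D,m) ≠ (3,3)`, have no non-scalar stabilizer element of order invertible in
`K`**: `γ ∈ stab(f)`, `γ^N = 1`, `N ≠ 0` in `K` force `γ = ζ · 1`, `ζ^D = 1` (§ 3 + § 4). In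
characteristic `p` this is the statement for all elements of order prime to `p`; the elements of
`p`-power order (unipotent) are the residue of `poonen2005_thm_3` not treated here.
[cite: Poonen2005, Thm. 3] -/
theorem isZariskiGeneric_forall_mem_linStabilizer_pow_eq_one (hD : 3 ≤ D) (hm : 3 ≤ m)
    (h33 : D = 3 → 4 ≤ m) :
    IsZariskiGeneric D fun f : MvPolynomial (Fin m) K =>
      ∀ γ ∈ linStabilizer f, ∀ N : ℕ, (N : K) ≠ 0 → γ ^ N = 1 →
        ∃ ζ : K, ζ ^ D = 1 ∧ (γ : Matrix (Fin m) (Fin m) K) = ζ • (1 : Matrix (Fin m) (Fin m) K) := by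
  refine (isZariskiGeneric_forall_mem_linStabilizer_diagonalizable (K := K) hD hm h33).mono'
    fun f _ h γ hγ N hNK hγN => ?_
  have hγN' : ((γ : GL (Fin m) K) : Matrix (Fin m) (Fin m) K) ^ N = 1 := by
    rw [← Units.val_pow_eq_pow_val, hγN, Units.val_one]
  obtain ⟨P, c, hP, hPc⟩ := exists_mul_eq_mul_diagonal_of_pow_eq_one_of_natCast_ne_zero hNK hγN'
  exact h γ hγ P c hP hPc

/-- **Generic finiteness of the stabilizer over every algebraically closed field with `D ≠ 0` in `K`**
(`D ≥ 3`, `n + 2` variables): almost all forms of degree `D` are nonsingular (§ 1), and a nonsingular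
form of degree `D ≥ 3` with `D ≠ 0` in `K` has a finite stabilizer (t14's Koszul route,
`finite_linStabilizer_of_isNonsingularForm_of_natCast_ne_zero`). The `K = ℂ` statement is the tree's
`isZariskiGeneric_finite_linStabilizer` (BI 2017 Thm. 2.3, first sentence; t13's Lie-algebra route).
[cite: BurgisserIkenmeyer2017, Thm. 2.3 (first sentence)] -/
theorem isZariskiGeneric_finite_linStabilizer_of_natCast_ne_zero (hD : 3 ≤ D) (hDK : (D : K) ≠ 0) :
    IsZariskiGeneric D fun f : MvPolynomial (Fin (n + 2)) K => Finite (linStabilizer f) :=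
  (isZariskiGeneric_isNonsingularForm_of_isAlgClosed (K := K) (n := n) (by omega)).mono'
    fun _ hf hns => finite_linStabilizer_of_isNonsingularForm_of_natCast_ne_zero hf hD hDK hns

/-- **Characteristic `p ∤ D` (every algebraically closed `K` with `D ≠ 0` in `K`; `D ≥ 3`, `m ≥ 3`,
`(D,m) ≠ (3,3)`)**: almost all forms of degree `D` in `m` variables have a FINITE stabilizer all of
whose elements of order invertible in `K` (order prime to the characteristic) are scalars `ζ · 1`,
`ζ^D = 1`. What is NOT proved here: that the elements of `p`-power order are trivial too (the
unipotent residue of `poonen2005_thm_3`). [cite: Poonen2005, Thm. 3] -/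
theorem isZariskiGeneric_forall_mem_linStabilizer_of_natCast_ne_zero (hD : 3 ≤ D) (hm : 3 ≤ m)
    (h33 : D = 3 → 4 ≤ m) (hDK : (D : K) ≠ 0) :
    IsZariskiGeneric D fun f : MvPolynomial (Fin m) K =>
      Finite (linStabilizer f) ∧ ∀ γ ∈ linStabilizer f, ((orderOf γ : ℕ) : K) ≠ 0 →
        ∃ ζ : K, ζ ^ D = 1 ∧ (γ : Matrix (Fin m) (Fin m) K) = ζ • (1 : Matrix (Fin m) (Fin m) K) := by
  obtain ⟨n, rfl⟩ : ∃ n, m = n + 2 := ⟨m - 2, by omega⟩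
  refine ((isZariskiGeneric_finite_linStabilizer_of_natCast_ne_zero (K := K) (n := n) hD hDK).and'
    (isZariskiGeneric_forall_mem_linStabilizer_pow_eq_one (K := K) hD hm h33)).mono'
    fun f _ h => ⟨h.1, fun γ hγ hoK => h.2 γ hγ (orderOf γ) hoK (pow_orderOf_eq_one γ)⟩

/-- **Almost all forms of degree `D ≥ 3` in `m ≥ 3` variables, `(D,m) ≠ (3,3)`, have a trivial
stabilizer `stab(w) = μ_D · 1`, over EVERY algebraically closed field of characteristic `0`**
(Matsumura–Monsky; BI 2017 §2.1 for `m > 3`; the stabilizer form of Poonen 2005 Thm. 3). The tree's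
`isZariskiGeneric_hasTrivialStabilizer` is the case `K = ℂ`; here no input is specific to `ℂ`: generic
finiteness from § 1 + t14's `finite_linStabilizer_of_isNonsingularForm_of_natCast_ne_zero`, every
element then has finite order `N ≠ 0` in `K`, and § 4–§ 3 apply.
[cite: BurgisserIkenmeyer2017, §2.1 ("almost all w ∈ Sym^D ℂ^m have a trivial stabilizer")] -/
theorem isZariskiGeneric_hasTrivialStabilizer_of_charZero [CharZero K] (hD : 3 ≤ D) (hm : 3 ≤ m)
    (h33 : D = 3 → 4 ≤ m) :
    IsZariskiGeneric D (HasTrivialStabilizer D : MvPolynomial (Fin m) K → Prop) := by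
  refine (isZariskiGeneric_forall_mem_linStabilizer_of_natCast_ne_zero (K := K) hD hm h33
    (Nat.cast_ne_zero.mpr (by omega))).mono' fun f _ h γ hγ => ?_
  haveI : Finite (linStabilizer f) := h.1
  have hfo : IsOfFinOrder (⟨γ, hγ⟩ : linStabilizer f) := isOfFinOrder_of_finite _
  have ho : 0 < orderOf γ := by
    rw [← Subgroup.orderOf_mk γ hγ]; exact hfo.orderOf_pos
  exact h.2 γ hγ (Nat.cast_ne_zero.mpr ho.ne')

/-- **Poonen 2005, Thm. 3 — every algebraically closed field of CHARACTERISTIC `0`, PROVED** (the body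
of the tree's fact `poonen2005_thm_3` at `K`, verbatim, plus the one hypothesis `[CharZero K]`): for
`n ≥ 1`, `d ≥ 3`, `(n,d) ≠ (1,3)`, the generic hypersurface of degree `d` in `ℙ^{n+1}_K` is smooth and
has `Lin X = {1}`. Smoothness: § 1; `Lin X = {1}`: `isZariskiGeneric_hasTrivialStabilizer_of_charZero`
and the dictionary `hasTrivialLinAut_iff_hasTrivialStabilizer`. Sibling of
`SmoothFormFiniteStabilizerAllFields.poonen2005_thm_2_of_charZero`. The fact itself (every algebraically
closed field, ANY characteristic) is NOT discharged: positive characteristic needs the unipotent count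
(module docstring). [cite: Poonen2005, Thm. 3] -/
theorem poonen2005_thm_3_of_charZero (K : Type*) [Field K] [IsAlgClosed K] [CharZero K] (n d : ℕ)
    (hn : 1 ≤ n) (hd : 3 ≤ d) (hnd : (n, d) ≠ (1, 3)) :
    IsZariskiGeneric d fun f : MvPolynomial (Fin (n + 2)) K =>
      IsNonsingularForm K f ∧ HasTrivialLinAut f := by
  have h33 : d = 3 → 4 ≤ n + 2 := by
    intro h3
    by_contra hlt
    exact hnd (Prod.ext (by simp only; omega) h3)
  refine ((isZariskiGeneric_isNonsingularForm_of_isAlgClosed (K := K) (n := n) (D := d) (by omega)).and'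
    (isZariskiGeneric_hasTrivialStabilizer_of_charZero (K := K) (D := d) (m := n + 2) hd (by omega)
      h33)).mono' fun f hf h => ⟨h.1, ?_⟩
  exact (hasTrivialLinAut_iff_hasTrivialStabilizer hf (by omega) (ne_zero_of_isNonsingularForm h.1)).mpr
    h.2

/-- The statement of `poonen2005_thm_3` restricted to characteristic `0`, in the fact's own binder
shape (`∀ K, [Field K] → [IsAlgClosed K] → …` with `[CharZero K]` added): a one-line re-export of
`poonen2005_thm_3_of_charZero` for by-name consumers. [cite: Poonen2005, Thm. 3] -/
theorem poonen2005_thm_3_charZero :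
    ∀ (K : Type) [Field K] [IsAlgClosed K] [CharZero K] (n d : ℕ), 1 ≤ n → 3 ≤ d → (n, d) ≠ (1, 3) →
      IsZariskiGeneric d fun f : MvPolynomial (Fin (n + 2)) K =>
        IsNonsingularForm K f ∧ HasTrivialLinAut f :=
  fun K _ _ _ n d hn hd hnd => poonen2005_thm_3_of_charZero K n d hn hd hnd

end AlgClosed

end Literature.Computability.AlgebraicComplexity

end
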